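import Summits.CriticalPhenomena.PercolationContinuityZ3.Theorems.Transplant.SkelConcClosureHab
import HarnessLib

/-!
# L7.4 — the generic (D) partial closure, SHARED-CHOICE form over a `PlanarSkeletonConc`: the instance's choices as ONE function
# (`SkelConc.ChoiceFn`), the three residues as three INDEPENDENT statements about it (`RootHoldsFn`, `FaceHoldsRFn`, `ReachHoldsRHFn`), and
# **`samePDropOfSkeletonConcLt_of_choiceFnRH`** — so that the root chain (D8), the faces and the corridors of the generic instance land as three
# separate files by three seats (generic twin of `BoxProdZ2ConcChoice` p222320 + `BoxProdZ2ConcClosureRun` §3–§4 p224455; logistics only)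

builds on p205010 (kernel theorem, internal audit signed; external expert review pending) — nothing in this file uses p205010.
Status sentence (coordinator 2026-08-20T04:30Z): "θ(p_c) = 0 on ℤ^d, all d ≥ 2 — kernel-verified (Lean 4/Mathlib, standard axioms); internal adversarial
audit SIGNED 2026-08-20 04:29Z; external expert review pending."
Lane `prim-bschramm-*`, seat `prim-bschramm-stmt` (gen 7); helper file (`--supports stmt-CriticalPhenomena-4575`).
`samePDropOfSkeletonConcLt_of_concSG_residuesRH` (SkelConcClosureHab) asks for ONE statement `hres` whose quantifier prefix
(`∃ δin m₀, ∀ msel M₀, ∃ S, ∀ q, ∃ C Λ, …`) is SHARED by the three residues; here the choices become data: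
* `SkelConc.Consts` — the handed-over p-free constants `K₀ δ δ₂ δr` with their bounds (NO degree field: the degree parameter is `Φ.Δ`,
  CONC-PARAMS-GENERIC §5 (D1));
* `SkelConc.Choice κ Φ t p hC` — the instance's choices at a centred `(Φ, t, p)`: `δin > 0`, `m₀`, the scale set `S msel M₀ ⊆ [M₀, ∞)`, and per
  running parameter the planar cells `C msel M₀ q` and schedule `Λ msel M₀ q` (base vertices `Φ.types` play the product's `V₀`);
  `Choice.AtQ` (the premises of step (B): inner sizes as produced by Step I, `q ∈ [p/2, p]`, the inputs over `Φ.types × S` at accuracy `δin` hold at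
  `q`, `Φ.CylSubcritical q`), `Choice.scheme` (= `concSchemeSG Φ C t Λ q κ.δ`), `.faces` (= `Skel.faceDataSG Φ C t Λ`);
* `Choice.WFHolds / RootHolds / FaceHoldsR / ReachHoldsRH` — `∀ msel M₀ q, AtQ → Skel.WFS ∧ K₀ ≤ K` / `Skel.RootOblT` / `Skel.FaceOblR` /
  `Skel.ReachOblRH` (the packaging-agnostic habitat form, SkelKitResiduesHab) at the chosen scheme (degree parameter `Φ.Δ`);
* `SkelConc.ChoiceFn` — a choice for every `κ` and every admissible centred `(G, Φ, t, p, hC)`; `WFHoldsFn`, `RootHoldsFn`, `FaceHoldsRFn`, `ReachHoldsRHFn`;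
* **`samePDropOfSkeletonConcLt_of_choiceFnRH (𝒞₀) (hWF) (hR) (hF) (hRe) : SamePDropOfSkeletonConcLt`**.
USE: stmt defines the concrete generic `concChoice₀ : ChoiceFn` (CONC-PARAMS-GENERIC.md) + `WFHoldsFn concChoice₀`; then `RootHoldsFn concChoice₀`
(p2 lineage), `FaceHoldsRFn concChoice₀` (p3/hp-8 lineage), `ReachHoldsRHFn concChoice₀` (p5 lineage) are three independent theorems, and the node of
record follows — builds on p205010 (kernel theorem, internal audit signed; external expert review pending).
[cite: KozmaNitzan2024, §4 Theorem 6 (pp. 25–31); §1 p. 2 (approach 1)]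
-/

noncomputable section

open MeasureTheory ProbabilityTheory
open scoped ENNReal Classical

namespace Summit.CriticalPhenomena.PercolationContinuityZ3.Theorems

namespace Transplant

namespace SkelConc

open Literature.Probability.Percolation Literature.Probability.LatticeModels SimpleGraph KNCells
open BoxProdZ2 (ConcRadiiG)

/-! ## §1 Constants and choices as data -/

/-- **The constants handed to the generic instance** by the partial closure (all p-free): the minimal number of stub levels `K₀`, the chain
accuracy `δ` (= the scheme's `δc`), the face-kit accuracy `δ₂`, the root-chain accuracies `δr n`.  (The degree bound is the field `Φ.Δ`.)
[this work] -/
structure Consts where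
  /-- minimal number of stub levels -/
  K₀ : ℕ
  /-- corridor-chain kit accuracy (= the scheme's `δc`) -/
  δ : ℝ
  /-- face-kit accuracy -/
  δ₂ : ℝ
  /-- root-chain kit accuracy for a chain of length `n + 1` -/
  δr : ℕ → ℝ
  hδ0 : 0 < δ
  hδ1 : δ ≤ 1
  hδ₂0 : 0 < δ₂
  hδ₂1 : δ₂ ≤ 1
  hδr : ∀ n, 0 < δr n ∧ δr n ≤ 1

variable {V : Type} [DecidableEq V] [Countable V] {G : SimpleGraph V} [G.LocallyFinite]

/-- **The generic instance's choices at a centred `(Φ, t, p)`** for the constants `κ`: input accuracy, minimal inner size, the finite scale set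
(a function of the inner sizes / threshold produced by Step I), and per running parameter the planar cells and the fibre-radius schedule.
[this work] -/
structure Choice (κ : Consts) (Φ : PlanarSkeletonConc G) (t : V) (p : unitInterval) (hC : Φ.toPlanarSkeleton.CylSubcritical p) where
  /-- input accuracy -/
  δin : ℝ
  /-- minimal inner size -/
  m₀ : ℕ
  /-- the finite set of planar scales, given the inner sizes and the threshold -/
  S : (V → ℕ) → ℕ → Finset ℕ
  /-- the planar cells at the running parameter -/
  C : (V → ℕ) → ℕ → unitInterval → PCells
  /-- the fibre-radius schedule at the running parameter -/
  Λ : (V → ℕ) → ℕ → unitInterval → ConcRadiiG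
  δin_pos : 0 < δin
  S_ge : ∀ (msel : V → ℕ) (M₀ : ℕ), (∀ τ ∈ Φ.types, m₀ ≤ msel τ ∧ msel τ < M₀) → ∀ M ∈ S msel M₀, M₀ ≤ M

namespace Choice

variable {κ : Consts} {Φ : PlanarSkeletonConc G} {t : V} {p : unitInterval} {hC : Φ.toPlanarSkeleton.CylSubcritical p}

/-- **The premises of step (B) at the running parameter `q`**: inner sizes / threshold as produced by Step I, `q ∈ [p/2, p]`, the inputs over
`Φ.types × S` hold at `q` with accuracy `δin`, and `Φ.CylSubcritical q`. [this work] -/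
def AtQ (𝒞 : Choice κ Φ t p hC) (msel : V → ℕ) (M₀ : ℕ) (q : unitInterval) : Prop :=
  (∀ τ ∈ Φ.types, 𝒞.m₀ ≤ msel τ ∧ msel τ < M₀) ∧ (p : ℝ) / 2 ≤ q ∧ (q : ℝ) ≤ p ∧
    (∀ i ∈ Skel.inputIndex Φ (𝒞.S msel M₀), 1 - 𝒞.δin < (bondPercolation G q).real (Skel.inputEvent Φ hC msel i)) ∧
    Φ.toPlanarSkeleton.CylSubcritical q

/-- The chosen anchored-cells scheme at `q` (`concSchemeSG` with `δc := κ.δ`). [this work] -/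
abbrev scheme (𝒞 : Choice κ Φ t p hC) (msel : V → ℕ) (M₀ : ℕ) (q : unitInterval) : KSchA V ℕ :=
  concSchemeSG Φ (𝒞.C msel M₀ q) t (𝒞.Λ msel M₀ q) q κ.δ

/-- The chosen face data at `q`. [this work] -/
abbrev faces (𝒞 : Choice κ Φ t p hC) (msel : V → ℕ) (M₀ : ℕ) (q : unitInterval) : FaceData V ℕ :=
  Skel.faceDataSG Φ (𝒞.C msel M₀ q) t (𝒞.Λ msel M₀ q)

/-- **Well-formedness of the choices**: the schedule is slack-well-formed and the cells have `≥ K₀` stub levels whenever `AtQ`. [this work] -/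
def WFHolds (𝒞 : Choice κ Φ t p hC) : Prop :=
  ∀ (msel : V → ℕ) (M₀ : ℕ) (q : unitInterval), 𝒞.AtQ msel M₀ q → Skel.WFS (𝒞.C msel M₀ q) (𝒞.Λ msel M₀ q) ∧ κ.K₀ ≤ (𝒞.C msel M₀ q).K

/-- **The root residue at the choices** (D8; KN §4 (32) at the root). [this work] -/
def RootHolds (𝒞 : Choice κ Φ t p hC) : Prop :=
  ∀ (msel : V → ℕ) (M₀ : ℕ) (q : unitInterval), 𝒞.AtQ msel M₀ q → Skel.RootOblT G (𝒞.scheme msel M₀ q) Φ.Δ κ.δr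

/-- **The face residue at the choices, run-restricted form** (KN §4 p. 30, Step III). [this work] -/
def FaceHoldsR (𝒞 : Choice κ Φ t p hC) : Prop :=
  ∀ (msel : V → ℕ) (M₀ : ℕ) (q : unitInterval), 𝒞.AtQ msel M₀ q →
    Skel.FaceOblR Φ (𝒞.scheme msel M₀ q) (𝒞.faces msel M₀ q) Φ.Δ κ.δ₂

/-- **The corridor residue at the choices, run-restricted habitat form** (KN §4 p. 30, Step IV; Lemma 12). [this work] -/
def ReachHoldsRH (𝒞 : Choice κ Φ t p hC) : Prop :=
  ∀ (msel : V → ℕ) (M₀ : ℕ) (q : unitInterval), 𝒞.AtQ msel M₀ q →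
    Skel.ReachOblRH G (𝒞.scheme msel M₀ q) (𝒞.faces msel M₀ q) Φ.Δ κ.δ

end Choice

/-- **A choice function**: the generic instance's choices for every handed constants `κ` and every admissible CENTRED `(G, Φ, t, p, hC)`
(`G` connected, `t ∈ Φ.types`, `Φ.φ t = 0`, `0 < p < 1`, `Φ.CylSubcritical p`). [this work] -/
def ChoiceFn : Type 1 :=
  ∀ (κ : Consts) {V : Type} [DecidableEq V] [Countable V] (G : SimpleGraph V) [G.LocallyFinite] (Φ : PlanarSkeletonConc G),
    G.Connected → ∀ (t : V), t ∈ Φ.types → Φ.φ t = 0 → ∀ (p : unitInterval), 0 < (p : ℝ) → (p : ℝ) < 1 →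
      ∀ (hC : Φ.toPlanarSkeleton.CylSubcritical p), Choice κ Φ t p hC

/-- The well-formedness obligation of a choice function. [this work] -/
def WFHoldsFn (𝒞₀ : ChoiceFn) : Prop :=
  ∀ (κ : Consts) {V : Type} [DecidableEq V] [Countable V] (G : SimpleGraph V) [G.LocallyFinite] (Φ : PlanarSkeletonConc G)
    (hc : G.Connected) (t : V) (ht : t ∈ Φ.types) (h0 : Φ.φ t = 0) (p : unitInterval) (hp0 : 0 < (p : ℝ)) (hp1 : (p : ℝ) < 1)
    (hC : Φ.toPlanarSkeleton.CylSubcritical p), (𝒞₀ κ G Φ hc t ht h0 p hp0 hp1 hC).WFHolds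

/-- **The root obligation of a choice function** (D8; the (R) residue seat's `Skel.RootOblA` + `rootOblT_of_rootOblA` serve). [this work] -/
def RootHoldsFn (𝒞₀ : ChoiceFn) : Prop :=
  ∀ (κ : Consts) {V : Type} [DecidableEq V] [Countable V] (G : SimpleGraph V) [G.LocallyFinite] (Φ : PlanarSkeletonConc G)
    (hc : G.Connected) (t : V) (ht : t ∈ Φ.types) (h0 : Φ.φ t = 0) (p : unitInterval) (hp0 : 0 < (p : ℝ)) (hp1 : (p : ℝ) < 1)
    (hC : Φ.toPlanarSkeleton.CylSubcritical p), (𝒞₀ κ G Φ hc t ht h0 p hp0 hp1 hC).RootHolds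

/-- **The face obligation of a choice function, run-restricted form** (KN §4 p. 30, Step III). [this work] -/
def FaceHoldsRFn (𝒞₀ : ChoiceFn) : Prop :=
  ∀ (κ : Consts) {V : Type} [DecidableEq V] [Countable V] (G : SimpleGraph V) [G.LocallyFinite] (Φ : PlanarSkeletonConc G)
    (hc : G.Connected) (t : V) (ht : t ∈ Φ.types) (h0 : Φ.φ t = 0) (p : unitInterval) (hp0 : 0 < (p : ℝ)) (hp1 : (p : ℝ) < 1)
    (hC : Φ.toPlanarSkeleton.CylSubcritical p), (𝒞₀ κ G Φ hc t ht h0 p hp0 hp1 hC).FaceHoldsR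

/-- **The corridor obligation of a choice function, run-restricted habitat form** (KN §4 p. 30, Step IV). [this work] -/
def ReachHoldsRHFn (𝒞₀ : ChoiceFn) : Prop :=
  ∀ (κ : Consts) {V : Type} [DecidableEq V] [Countable V] (G : SimpleGraph V) [G.LocallyFinite] (Φ : PlanarSkeletonConc G)
    (hc : G.Connected) (t : V) (ht : t ∈ Φ.types) (h0 : Φ.φ t = 0) (p : unitInterval) (hp0 : 0 < (p : ℝ)) (hp1 : (p : ℝ) < 1)
    (hC : Φ.toPlanarSkeleton.CylSubcritical p), (𝒞₀ κ G Φ hc t ht h0 p hp0 hp1 hC).ReachHoldsRH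

/-! ## §2 The node of record from a choice function -/

/-- **THE GENERIC (D) PARTIAL CLOSURE, shared-choice form**: a choice function whose choices are slack-well-formed and satisfy the root, face and
corridor obligations (run-restricted, habitat form) gives the node of record `SamePDropOfSkeletonConcLt` (through
`samePDropOfSkeletonConcLt_of_concSG_residuesRH`). [cite: KozmaNitzan2024, §4 Theorem 6; §1 p. 2 (approach 1)] -/
theorem samePDropOfSkeletonConcLt_of_choiceFnRH (𝒞₀ : ChoiceFn) (hWF : WFHoldsFn 𝒞₀) (hR : RootHoldsFn 𝒞₀) (hF : FaceHoldsRFn 𝒞₀)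
    (hRe : ReachHoldsRHFn 𝒞₀) : SamePDropOfSkeletonConcLt := by
  refine samePDropOfSkeletonConcLt_of_concSG_residuesRH fun K₀ δ δ₂ δr hδ0 hδ1 hδ₂0 hδ₂1 hδr {V} _ _ G _ Φ hc t ht h0 p hp0 hp1 hC => ?_
  set κ : Consts := ⟨K₀, δ, δ₂, δr, hδ0, hδ1, hδ₂0, hδ₂1, hδr⟩ with hκ
  set 𝒞 := 𝒞₀ κ G Φ hc t ht h0 p hp0 hp1 hC with h𝒞
  refine ⟨𝒞.δin, 𝒞.m₀, 𝒞.δin_pos, fun msel M₀ hmsel => ⟨𝒞.S msel M₀, 𝒞.S_ge msel M₀ hmsel, fun q hq1 hq2 hin hCq => ?_⟩⟩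
  have hat : 𝒞.AtQ msel M₀ q := ⟨hmsel, hq1, hq2, hin, hCq⟩
  obtain ⟨hwf, hK⟩ := hWF κ G Φ hc t ht h0 p hp0 hp1 hC msel M₀ q hat
  exact ⟨𝒞.C msel M₀ q, 𝒞.Λ msel M₀ q, hwf, hK, hR κ G Φ hc t ht h0 p hp0 hp1 hC msel M₀ q hat,
    hF κ G Φ hc t ht h0 p hp0 hp1 hC msel M₀ q hat, hRe κ G Φ hc t ht h0 p hp0 hp1 hC msel M₀ q hat⟩

end SkelConc

end Transplant

end Summit.CriticalPhenomena.PercolationContinuityZ3.Theorems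

end
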